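import Literature.AnabelianGeometry.EtaleTheta.ZHatPadicCharacter
import Mathlib.Data.Nat.Factorization.Basic
import HarnessLib

/-!
# `Ẑ^× ↠ ℤ_p^×`: the `p`-adic cyclotomic character of `Aut(Ẑ)` is SURJECTIVE

Classical complement to `ZHatPadicCharacter.lean` [RibesZalesskii2010, Thm 2.7.1] (`Ẑ^× ≅ ∏_ℓ ℤ_ℓ^× ↠ ℤ_p^×`):
the first arrow of "the natural homomorphism `Ẑ^× ↠ ℤ_p^× ↪ Ism`" of [IUTchII] Example 1.8 (iv) (kurims p. 39) is
onto.  PROOF-ONLY (no definitions): for `a ∈ ℤ_p` the compatible family `(c_n)_n`, `c_n ≡ a (mod p^{v_p(n)})`,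
`c_n ≡ 1 (mod n / p^{v_p(n)})` (Chinese remainder), is multiplicative in `a`; for a unit `a` it is a family of units,
hence (`ZHatLevel.autOfLevelFamily`, `ZHatLevelDetermination.lean`) the level characters of an automorphism of `Ẑ`,
whose `p`-adic character is `a` (`eq_padicChar_of_toZModPow`).

* `ZHatLevel.exists_levelFamily_padic` — the multiplicative CRT section `ℤ_p → (lim_n ℤ/nℤ)`;
* `ZHatLevel.padicChar_surjective_units`, `ZHatLevel.padicCharUnits_surjective` — **`χ_p : Ẑ^× → ℤ_p^×` is onto**.

HONEST FRAMING: classical profinite bookkeeping; nothing here bears on [IUTchIII] Cor. 3.12.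
-/

noncomputable section

open CategoryTheory ProfiniteGrp ProfiniteGrp.ProfiniteCompletion

namespace Literature.AnabelianGeometry.EtaleTheta

namespace ZHatLevel

variable (p : ℕ) [hp : Fact p.Prime]

/-- **The multiplicative Chinese-remainder section `ℤ_p → lim_n ℤ/nℤ`**: there is a map `F` from `ℤ_p` to compatible
families `(c_n ∈ ℤ/nℤ)_n` which is multiplicative, sends `1` to the unit family, and whose `p^k`-components are the
reductions `a mod p^k` (its prime-to-`p` components are `1`). [cite: RibesZalesskii2010, Thm 2.7.1] -/
theorem exists_levelFamily_padic :
    ∃ F : ℤ_[p] → LevelFamily,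
      (∀ (a b : ℤ_[p]) (n : ℕ+), (F (a * b)).c n = (F a).c n * (F b).c n) ∧
      (∀ n : ℕ+, (F 1).c n = 1) ∧
      ∀ (a : ℤ_[p]) (k : ℕ), ((F a).c (ppow p k) : ZMod (p ^ k)) = PadicInt.toZModPow k a := by
  classical
  have hp' : p.Prime := hp.out
  -- `v n`, `q n = p^{v n}`, `m n = n / q n`, coprime
  let v : ℕ+ → ℕ := fun n => (n : ℕ).factorization p
  have hqm : ∀ n : ℕ+, p ^ v n * ((n : ℕ) / p ^ v n) = n := fun n => Nat.ordProj_mul_ordCompl_eq_self n p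
  have hco : ∀ n : ℕ+, (p ^ v n).Coprime ((n : ℕ) / p ^ v n) := fun n =>
    (Nat.coprime_ordCompl hp' n.ne_zero).pow_left (v n)
  -- the `p`-part residue of `a` at level `n`
  let r : ℤ_[p] → ℕ+ → ℕ := fun a n => (PadicInt.toZModPow (v n) a).val
  -- CRT representative
  let x : ℤ_[p] → ℕ+ → ℕ := fun a n => (Nat.chineseRemainder (hco n) (r a n) 1 : ℕ)
  have hxq : ∀ (a : ℤ_[p]) (n : ℕ+), x a n ≡ r a n [MOD p ^ v n] := fun a n =>
    (Nat.chineseRemainder (hco n) (r a n) 1).2.1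
  have hxm : ∀ (a : ℤ_[p]) (n : ℕ+), x a n ≡ 1 [MOD (n : ℕ) / p ^ v n] := fun a n =>
    (Nat.chineseRemainder (hco n) (r a n) 1).2.2
  -- gluing two congruences into one mod `n`
  have hglue : ∀ (n : ℕ+) {s t : ℕ}, s ≡ t [MOD p ^ v n] → s ≡ t [MOD (n : ℕ) / p ^ v n] → s ≡ t [MOD n] := by
    intro n s t h1 h2
    have h := (Nat.modEq_and_modEq_iff_modEq_mul (hco n)).mp ⟨h1, h2⟩
    rwa [hqm n] at h
  -- the residues of `a` are compatible: `r a N ≡ r a n (mod p^{v n})` when `v n ≤ v N`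
  have hr_compat : ∀ (a : ℤ_[p]) {j J : ℕ}, j ≤ J →
      (PadicInt.toZModPow J a).val ≡ (PadicInt.toZModPow j a).val [MOD p ^ j] := by
    intro a j J hjJ
    have h := PadicInt.cast_toZModPow j J hjJ a
    haveI : NeZero (p ^ J) := ⟨pow_ne_zero J hp'.ne_zero⟩
    rw [ZMod.cast_eq_val] at h
    -- `h : ((toZModPow J a).val : ZMod (p^j)) = toZModPow j a`
    have h' := congrArg ZMod.val h
    rw [ZMod.val_natCast] at h'
    -- `h' : (toZModPow J a).val % p^j = (toZModPow j a).val`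
    rw [Nat.ModEq, h', Nat.mod_eq_of_lt (ZMod.val_lt _)]
  -- residues are multiplicative mod `p^{v n}`
  have hr_mul : ∀ (a b : ℤ_[p]) (n : ℕ+), r (a * b) n ≡ r a n * r b n [MOD p ^ v n] := by
    intro a b n
    haveI : NeZero (p ^ v n) := ⟨pow_ne_zero _ hp'.ne_zero⟩
    rw [← ZMod.natCast_eq_natCast_iff, Nat.cast_mul]
    change ((PadicInt.toZModPow (v n) (a * b)).val : ZMod (p ^ v n)) =
      ((PadicInt.toZModPow (v n) a).val : ZMod (p ^ v n)) * ((PadicInt.toZModPow (v n) b).val : ZMod (p ^ v n))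
    rw [ZMod.natCast_zmod_val, ZMod.natCast_zmod_val, ZMod.natCast_zmod_val, map_mul]
  have hr_one : ∀ n : ℕ+, r 1 n ≡ 1 [MOD p ^ v n] := by
    intro n
    change (PadicInt.toZModPow (v n) (1 : ℤ_[p])).val ≡ 1 [MOD p ^ v n]
    rw [map_one, ZMod.val_one_eq_one_mod]
    exact Nat.mod_modEq 1 _
  -- the family
  let F : ℤ_[p] → LevelFamily := fun a =>
    { c := fun n => (x a n : ZMod n)
      compat := fun n N h => by
        rw [map_natCast, ZMod.natCast_eq_natCast_iff]
        have hN0 : (N : ℕ) ≠ 0 := N.ne_zero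
        have hvle : v n ≤ v N := (Nat.factorization_le_iff_dvd n.ne_zero hN0).mpr h p
        refine hglue n ?_ ?_
        · -- mod `p^{v n}`
          have h1 : x a N ≡ r a N [MOD p ^ v n] :=
            (hxq a N).of_dvd (pow_dvd_pow p hvle)
          exact (h1.trans (hr_compat a hvle)).trans (hxq a n).symm
        · -- mod the prime-to-`p` part
          have h2 : x a N ≡ 1 [MOD (n : ℕ) / p ^ v n] :=
            (hxm a N).of_dvd (Nat.ordCompl_dvd_ordCompl_of_dvd h p)
          exact h2.trans (hxm a n).symm }
  refine ⟨F, fun a b n => ?_, fun n => ?_, fun a k => ?_⟩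
  · -- multiplicativity
    change (x (a * b) n : ZMod n) = (x a n : ZMod n) * (x b n : ZMod n)
    rw [← Nat.cast_mul, ZMod.natCast_eq_natCast_iff]
    refine hglue n ?_ ?_
    · exact ((hxq (a * b) n).trans (hr_mul a b n)).trans ((hxq a n).mul (hxq b n)).symm
    · have h := (hxm a n).mul (hxm b n)
      rw [one_mul] at h
      exact (hxm (a * b) n).trans h.symm
  · -- unit
    change (x 1 n : ZMod n) = 1
    conv_rhs => rw [← Nat.cast_one]
    rw [ZMod.natCast_eq_natCast_iff]
    exact hglue n ((hxq 1 n).trans (hr_one n)) (hxm 1 n)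
  · -- `p^k`-components
    haveI : NeZero (p ^ k) := ⟨pow_ne_zero k hp'.ne_zero⟩
    have hvk : v (ppow p k) = k := by
      change (p ^ k).factorization p = k
      rw [Nat.factorization_pow, hp'.factorization]
      simp
    have hrk : r a (ppow p k) = (PadicInt.toZModPow k a).val := by
      change (PadicInt.toZModPow (v (ppow p k)) a).val = _
      have key : ∀ j, v (ppow p k) = j → (PadicInt.toZModPow (v (ppow p k)) a).val = (PadicInt.toZModPow j a).val := by
        intro j hj; subst hj; rfl
      exact key k hvk
    have h := hxq a (ppow p k)
    rw [hvk, hrk] at h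
    change (x a (ppow p k) : ZMod (p ^ k)) = PadicInt.toZModPow k a
    rw [(ZMod.natCast_eq_natCast_iff _ _ _).mpr h, ZMod.natCast_zmod_val]

/-- **`χ_p : Aut(Ẑ) → ℤ_p` hits every unit of `ℤ_p`** ("`Ẑ^× ↠ ℤ_p^×`", [IUTchII] Ex. 1.8 (iv) p. 39): the unit
family of `a ∈ ℤ_p^×` (CRT section) defines an automorphism of `Ẑ` (`autOfLevelFamily`) with `p`-adic character `a`.
[cite: RibesZalesskii2010, Thm 2.7.1] -/
theorem padicChar_surjective_units (a : ℤ_[p]ˣ) :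
    ∃ φ : MulAut (completion (GrpCat.of (Multiplicative ℤ))), padicChar p φ = a := by
  obtain ⟨F, hmul, hone, hpk⟩ := exists_levelFamily_padic p
  have hfg : ∀ n : ℕ+, (F (a : ℤ_[p])).c n * (F (a⁻¹ : ℤ_[p]ˣ)).c n = 1 := fun n => by
    rw [← hmul, Units.mul_inv, hone]
  refine ⟨autOfLevelFamily (F a) (F (a⁻¹ : ℤ_[p]ˣ)) hfg, ?_⟩
  symm
  refine eq_padicChar_of_toZModPow p fun k => ?_
  rw [levelChar_autOfLevelFamily]
  exact (hpk a k).symm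

/-- **`Ẑ^× ↠ ℤ_p^×`**: `padicCharUnits p` is SURJECTIVE. [cite: RibesZalesskii2010, Thm 2.7.1] -/
theorem padicCharUnits_surjective : Function.Surjective (padicCharUnits p) := fun a => by
  obtain ⟨φ, hφ⟩ := padicChar_surjective_units p a
  exact ⟨φ, Units.ext hφ⟩

end ZHatLevel

end Literature.AnabelianGeometry.EtaleTheta

end
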